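import Mathlib
import HarnessLib
import Summits.HubbardSuperconductivity.HubbardSuperconductivity.Theorems.KLProgrammeKLRegimeWickScaleFlowLines
import Summits.HubbardSuperconductivity.HubbardSuperconductivity.Theorems.KLProgrammeKLRegimeFrameShellCount

/-!
# Route `KLProgramme` — crux K3, ENGINE child gen 6 (stmt-HubbardSuperconductivity-20236 `KLRegimeEngineV16`), stub `stub_engine_step_values`,
# conjunct (E2-v10) at `1 ≤ n`: the SIGN-BLIND size of the `𝒲₆⊗𝒲₂` (S62) class of the within-slice source — `klws_sixTwo_term_norm_le`

Cell gate-hubbard-kl, seat hubbard-kl-p1 (g10; (E2) Wick-toolkit lane, author of the S62 identity `bubbleSum_sixTwo_pairLabels`).  The source `X` of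
the within-slice flow (`klws_flow_source_eq`, k3c1-p1 g6) contains, besides the two particle–hole bubbles, the two-line term with vertex degrees
`(6, 2)`: `S62(Λ; Z) = Σ_{p,σ} ℓ_Ċ(p)·ℓ_D(p)·𝒱₆(W)(ψ̂⁺_{pσ}, ψ̂⁻_{pσ}, Z)·Σ_W(p,σ)` with the derivative line `ℓ_Ċ = ẇ_Λ·βL²·ĝ_K` (supported on the shell
`Λ²/4 ≤ ω² + e_K² ≤ Λ²`, `|ẇ_Λ| ≤ (64/3)/Λ` — `klws_deriv_cutoffWeight_scale_eq_zero`, `klws_abs_deriv_cutoffWeight_scale_le`) and the soft line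
`ℓ_D = (1 − w_Λ)·βL²·ĝ_K`, both at the SAME label `p`.  This file bounds it sign-blind, by «sup × count» on the derivative shell:

* §1 `klws_norm_propCT_sq`: `‖ĝ_K(p)‖² = (ω_p² + e_K(p)²)⁻¹`;
* §2 `klws_sum_abs_derivWeight_div_le`: for every admissible frame (`FrameOK R U N μ K`, through the level count `card_frameLevel_le_le`), `0 < β`,
  `0 < Λ < 3/80`:  `Σ_p |ẇ_Λ(p)| / (ω_p² + e_K(p)²) ≤ (256/3)·Λ⁻³·((Λβ/π + 3)·(1793·Λ·L² + 704·L))` — the derivative-shell analogue of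
  `SliceCutoffGramConstant.sum_sliceWeightCT_div_sqrt_le` (one slice) [cite: BenfattoGiulianiMastropietro2006, §2.8 (2.80)];
* §3 **`klws_sixTwo_term_norm_le`**: for any `W`, any four legs `Z₀…Z₃`, and sup inputs `N₆ ≥ ‖𝒱₆(W)(ψ̂⁺_{pσ},ψ̂⁻_{pσ},Z)‖` (all `p, σ`) and
  `s₂ ≥ ‖Σ_W(p,σ)‖` on the shell, the S62 summand of `X` (with its `((βL²)³)⁻¹·2` prefactor, literally as in `klws_flow_source_eq`) has norm
  `≤ 4·N₆·s₂·(βL²)⁻¹·(256/3)·Λ⁻³·((Λβ/π + 3)·(1793ΛL² + 704L))` — i.e. `≲ 4N₆s₂·(256·1793/(3π))/Λ` per unit `Λ`, an `n`-UNIFORM constant times `N₆·s₂`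
  once integrated over a slice `dΛ/Λ`.

Why it matters (seat memo E2-SIGMA-DRESSING.md, evidence on 20236): with undressed lines, `N₆·s₂` is `n`-uniform (the pp-reducible part of S62 is the self-energy
dressing of the Cooper bubble, a relative `O(|z−1| + |a−1|)` correction to the Riccati term), so this class fits none of the gained (E2-v10) tokens and must be
carried inside the resummation (dressed rung weights); after dressing, the residual two-leg vertex is the soft self-contraction part (`≍ U·Λ_n²`) and THIS lemma
books its S62 as a gained term.  Pure analysis over tree lemmas; nothing about superconductivity is asserted.  0 kit.
-/

noncomputable section

namespace Summit.HubbardSuperconductivity.HubbardSuperconductivity.Theorems.KLRegimeWick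

set_option linter.dupNamespace false -- summit = problem name (single-conjunct summit), D-0017

open Finset Literature.MathematicalPhysics.QuantumLattice GrassmannAlgebra
open Literature.Probability.LatticeModels
open Summit.HubbardSuperconductivity.HubbardSuperconductivity.Theorems.TwoPointAssembly
open Summit.HubbardSuperconductivity.HubbardSuperconductivity.Theorems.KLProgrammeLegKernels
open Summit.HubbardSuperconductivity.HubbardSuperconductivity.Theorems.KLRegimeSplit

section Model

variable (L M : ℕ) [NeZero L] (β μ : ℝ) (K : TrigPolyC4v)

/-! ## §1 The frame propagator's squared modulus -/

omit [NeZero L] in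
/-- **`‖ĝ_K(p)‖² = (ω_p² + e_K(p)²)⁻¹`** for `ĝ_K(p) = 1/(−iω_p + e_K(p))` (`propCT`). -/
theorem klws_norm_propCT_sq (p : FreqMomentum L M) :
    ‖propCT L M β μ K p‖ ^ 2 = (matsubaraFreq β M p.1 ^ 2 + nambuXiCT L μ K p.2 ^ 2)⁻¹ := by
  have hz : ‖(-Complex.I * (matsubaraFreq β M p.1 : ℂ) + (nambuXiCT L μ K p.2 : ℂ))‖ ^ 2 =
      matsubaraFreq β M p.1 ^ 2 + nambuXiCT L μ K p.2 ^ 2 := by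
    rw [Complex.sq_norm, Complex.normSq_apply]
    simp
    ring
  rw [propCT, norm_div, norm_one, div_pow, hz, one_pow, one_div]

/-! ## §2 The derivative-shell phase-space sum (sup × count) -/

/-- **The phase-space sum of the derivative line over the squared propagator is `sup × count`.**  For an admissible frame (`FrameOK R U N μ K`),
`0 < β`, `0 < Λ < 3/80` and every `L ≥ 1`, `M`:
`Σ_{(ω,k⃗)} |∂_Λ w^K_Λ(ω,k⃗)| / (ω² + e_K(k⃗)²) ≤ (256/3)·Λ⁻³·((Λβ/π + 3)·(1793·Λ·L² + 704·L))`
(each summand vanishes off the shell `Λ²/4 ≤ ω² + e_K² ≤ Λ²`, where `|ẇ_Λ| ≤ (64/3)/Λ` and `(ω² + e_K²)⁻¹ ≤ 4/Λ²`; the shell lies in `{|ω| ≤ Λ} × {|e_K| ≤ Λ}`,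
counted by `card_filter_matsubaraFreq_le` × `card_frameLevel_le_le`). [cite: BenfattoGiulianiMastropietro2006, §2.8 (2.80)] -/
theorem klws_sum_abs_derivWeight_div_le {R : RenConsts} {U : ℝ} {N : ℕ} (hK : FrameOK R U N μ K) (hβ : 0 < β)
    {Λ : ℝ} (hΛ : 0 < Λ) (hΛr : Λ < 3 / 80) :
    ∑ k : FreqMomentum L M, |deriv (fun Λ' : ℝ => hubbardCutoffWeightCT L M β μ K Λ' k) Λ| /
        (matsubaraFreq β M k.1 ^ 2 + nambuXiCT L μ K k.2 ^ 2) ≤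
      256 / 3 / Λ ^ 3 * ((Λ * β / Real.pi + 3) * (1793 * Λ * (L : ℝ) ^ 2 + 704 * L)) := by
  classical
  have hΛ0 : Λ ≠ 0 := hΛ.ne'
  have hL : (0 : ℝ) < L := by exact_mod_cast Nat.pos_of_ne_zero (NeZero.ne L)
  -- the indicator of the box `{|ω| ≤ Λ} × {|e_K| ≤ Λ}`
  set ind : FreqMomentum L M → ℝ := fun k =>
    if |matsubaraFreq β M k.1| ≤ Λ ∧ |nambuXiCT L μ K k.2| ≤ Λ then 1 else 0 with hind
  have hind0 : ∀ k, 0 ≤ ind k := fun k => by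
    simp only [hind]
    split_ifs <;> norm_num
  -- pointwise majorant
  have hpt : ∀ k : FreqMomentum L M,
      |deriv (fun Λ' : ℝ => hubbardCutoffWeightCT L M β μ K Λ' k) Λ| / (matsubaraFreq β M k.1 ^ 2 + nambuXiCT L μ K k.2 ^ 2) ≤
        256 / 3 / Λ ^ 3 * ind k := by
    intro k
    set ω := matsubaraFreq β M k.1 with hω
    set ξ := nambuXiCT L μ K k.2 with hξ
    by_cases h0 : deriv (fun Λ' : ℝ => hubbardCutoffWeightCT L M β μ K Λ' k) Λ = 0
    · rw [h0, abs_zero, zero_div]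
      exact mul_nonneg (by positivity) (hind0 k)
    · -- on the shell
      have hshell : Λ ^ 2 / 4 ≤ ω ^ 2 + ξ ^ 2 ∧ ω ^ 2 + ξ ^ 2 ≤ Λ ^ 2 := by
        by_contra hc
        refine h0 (klws_deriv_cutoffWeight_scale_eq_zero L M β μ K hΛ0 k ?_)
        rw [not_and_or, not_le, not_le] at hc
        exact hc
      have hωΛ : |ω| ≤ Λ := abs_le_of_sq_le_sq' (by nlinarith [sq_nonneg ξ, hshell.2]) hΛ.le |> fun h => abs_le.2 h
      have hξΛ : |ξ| ≤ Λ := abs_le_of_sq_le_sq' (by nlinarith [sq_nonneg ω, hshell.2]) hΛ.le |> fun h => abs_le.2 h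
      have hind1 : ind k = 1 := by
        simp only [hind]
        rw [if_pos ⟨hωΛ, hξΛ⟩]
      rw [hind1, mul_one]
      have hE0 : 0 < ω ^ 2 + ξ ^ 2 := lt_of_lt_of_le (by positivity) hshell.1
      have hw : |deriv (fun Λ' : ℝ => hubbardCutoffWeightCT L M β μ K Λ' k) Λ| ≤ 64 / 3 / Λ := by
        have h := klws_abs_deriv_cutoffWeight_scale_le L M β μ K hΛ0 k
        rwa [abs_of_pos hΛ] at h
      have habs0 := abs_nonneg (deriv (fun Λ' : ℝ => hubbardCutoffWeightCT L M β μ K Λ' k) Λ)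
      rw [div_le_iff₀ hE0]
      -- `|ẇ| ≤ (64/3)/Λ` and `Λ²/4 ≤ E` give `|ẇ| ≤ (256/3)/Λ³ · E`
      calc |deriv (fun Λ' : ℝ => hubbardCutoffWeightCT L M β μ K Λ' k) Λ|
          ≤ 64 / 3 / Λ := hw
        _ = 256 / 3 / Λ ^ 3 * (Λ ^ 2 / 4) := by field_simp; ring
        _ ≤ 256 / 3 / Λ ^ 3 * (ω ^ 2 + ξ ^ 2) := mul_le_mul_of_nonneg_left hshell.1 (by positivity)
  -- count the box
  have hcountω : ((((univ : Finset (MatsubaraIdx M)).filter fun i => |matsubaraFreq β M i| ≤ Λ).card : ℕ) : ℝ) ≤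
      Λ * β / Real.pi + 3 :=
    card_filter_matsubaraFreq_le hβ hΛ.le _ fun i hi => (mem_filter.1 hi).2
  have hcountk : ((((univ : Finset (TorusSite 2 L)).filter fun k => |nambuXiCT L μ K k| ≤ Λ).card : ℕ) : ℝ) ≤
      1793 * Λ * (L : ℝ) ^ 2 + 704 * L :=
    card_frameLevel_le_le (L := L) hK hΛ.le hΛr
  have hsumind : ∑ k : FreqMomentum L M, ind k =
      ((((univ : Finset (MatsubaraIdx M)).filter fun i => |matsubaraFreq β M i| ≤ Λ).card : ℕ) : ℝ) *
        ((((univ : Finset (TorusSite 2 L)).filter fun k => |nambuXiCT L μ K k| ≤ Λ).card : ℕ) : ℝ) := by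
    simp only [hind]
    rw [sum_boole, ← Nat.cast_mul, ← card_filter_freqMomentum_eq]
  have hcnt0 : 0 ≤ 1793 * Λ * (L : ℝ) ^ 2 + 704 * L := by positivity
  calc ∑ k : FreqMomentum L M, |deriv (fun Λ' : ℝ => hubbardCutoffWeightCT L M β μ K Λ' k) Λ| /
          (matsubaraFreq β M k.1 ^ 2 + nambuXiCT L μ K k.2 ^ 2)
      ≤ ∑ k : FreqMomentum L M, 256 / 3 / Λ ^ 3 * ind k := sum_le_sum fun k _ => hpt k
    _ = 256 / 3 / Λ ^ 3 * ∑ k : FreqMomentum L M, ind k := by rw [mul_sum]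
    _ ≤ 256 / 3 / Λ ^ 3 * ((Λ * β / Real.pi + 3) * (1793 * Λ * (L : ℝ) ^ 2 + 704 * L)) := by
        refine mul_le_mul_of_nonneg_left ?_ (by positivity)
        rw [hsumind]
        exact mul_le_mul hcountω hcountk (Nat.cast_nonneg _) (by positivity)

/-! ## §3 The sign-blind bound of the S62 term of the source -/

/-- **Sign-blind size of the `𝒲₆⊗𝒲₂` (S62) term of the within-slice source.**  For an admissible frame, `0 < β`, `0 < Λ < 3/80`, ANY element `W`
of the field algebra, ANY four legs `Z₀ … Z₃`, and sup inputs `N₆` (the six-leg vertex function of `W` at the two contracted legs `ψ̂⁺_{pσ}, ψ̂⁻_{pσ}` and `Z`,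
all `p, σ`) and `s₂` (the self-energy of `W` on the derivative shell `Λ²/4 ≤ ω² + e_K² ≤ Λ²`), the S62 summand of `klws_flow_source_eq`'s source, prefactor
`((βL²)³)⁻¹·2` included, obeys
`‖((βL²)³)⁻¹·2·Σ_{p,σ} (ẇ_Λ(p)·βL²ĝ_K(p))·((1−w_Λ(p))·βL²ĝ_K(p))·𝒱₆(W)(ψ̂⁺_{pσ},ψ̂⁻_{pσ},Z)·Σ_W(p,σ)‖ ≤ 4·N₆·s₂·(βL²)⁻¹·(256/3)Λ⁻³·((Λβ/π+3)(1793ΛL²+704L))`. -/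
theorem klws_sixTwo_term_norm_le {R : RenConsts} {U : ℝ} {N : ℕ} (hK : FrameOK R U N μ K) (hβ : 0 < β)
    {Λ : ℝ} (hΛ : 0 < Λ) (hΛr : Λ < 3 / 80) (W : HubbardGrassmann L M) (Z₀ Z₁ Z₂ Z₃ : HubbardFieldIdx L M)
    {N₆ s₂ : ℝ} (hN₆ : 0 ≤ N₆) (hs₂ : 0 ≤ s₂)
    (hN : ∀ (p : FreqMomentum L M) (σ : Fin 2), ‖vertexFn L M β W 6 ![((p, σ), 0), ((p, σ), 1), Z₀, Z₁, Z₂, Z₃]‖ ≤ N₆)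
    (hs : ∀ (p : FreqMomentum L M) (σ : Fin 2), Λ ^ 2 / 4 ≤ matsubaraFreq β M p.1 ^ 2 + nambuXiCT L μ K p.2 ^ 2 →
      matsubaraFreq β M p.1 ^ 2 + nambuXiCT L μ K p.2 ^ 2 ≤ Λ ^ 2 → ‖selfEnergy L M β W p σ‖ ≤ s₂) :
    ‖((((β * (L : ℝ) ^ 2 : ℝ) : ℂ)) ^ 3)⁻¹ *
        (2 * ∑ p : FreqMomentum L M, ∑ σ : Fin 2,
          ((((deriv (fun Λ' : ℝ => hubbardCutoffWeightCT L M β μ K Λ' p) Λ : ℝ) : ℂ) *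
              (((β * (L : ℝ) ^ 2 : ℝ) : ℂ) * propCT L M β μ K p)) *
            (((1 - hubbardCutoffWeightCT L M β μ K Λ p : ℝ) : ℂ) *
              (((β * (L : ℝ) ^ 2 : ℝ) : ℂ) * propCT L M β μ K p))) *
          (vertexFn L M β W 6 ![((p, σ), 0), ((p, σ), 1), Z₀, Z₁, Z₂, Z₃] * selfEnergy L M β W p σ))‖ ≤
      4 * N₆ * s₂ * (β * (L : ℝ) ^ 2)⁻¹ *
        (256 / 3 / Λ ^ 3 * ((Λ * β / Real.pi + 3) * (1793 * Λ * (L : ℝ) ^ 2 + 704 * L))) := by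
  have hΛ0 : Λ ≠ 0 := hΛ.ne'
  have hL : (0 : ℝ) < L := by exact_mod_cast Nat.pos_of_ne_zero (NeZero.ne L)
  have hB : 0 < β * (L : ℝ) ^ 2 := by positivity
  set B : ℝ := β * (L : ℝ) ^ 2 with hBdef
  have hBn : ‖((B : ℝ) : ℂ)‖ = B := by rw [Complex.norm_real, Real.norm_eq_abs, abs_of_pos hB]
  -- abbreviations
  set wd : FreqMomentum L M → ℝ := fun p => deriv (fun Λ' : ℝ => hubbardCutoffWeightCT L M β μ K Λ' p) Λ with hwd
  set E : FreqMomentum L M → ℝ := fun p => matsubaraFreq β M p.1 ^ 2 + nambuXiCT L μ K p.2 ^ 2 with hE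
  -- termwise bound: `‖term(p,σ)‖ ≤ B² N₆ s₂ · |ẇ(p)| / E(p)`
  have hterm : ∀ (p : FreqMomentum L M) (σ : Fin 2),
      ‖((((wd p : ℝ) : ℂ) * (((B : ℝ) : ℂ) * propCT L M β μ K p)) *
            (((1 - hubbardCutoffWeightCT L M β μ K Λ p : ℝ) : ℂ) * (((B : ℝ) : ℂ) * propCT L M β μ K p))) *
          (vertexFn L M β W 6 ![((p, σ), 0), ((p, σ), 1), Z₀, Z₁, Z₂, Z₃] * selfEnergy L M β W p σ)‖ ≤
        B ^ 2 * N₆ * s₂ * (|wd p| / E p) := by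
    intro p σ
    by_cases h0 : wd p = 0
    · have : (((wd p : ℝ) : ℂ)) = 0 := by rw [h0]; simp
      rw [this]
      simp only [zero_mul, norm_zero]
      rw [h0, abs_zero, zero_div, mul_zero]
    · have hshell : Λ ^ 2 / 4 ≤ E p ∧ E p ≤ Λ ^ 2 := by
        by_contra hc
        refine h0 (klws_deriv_cutoffWeight_scale_eq_zero L M β μ K hΛ0 p ?_)
        rw [not_and_or, not_le, not_le] at hc
        exact hc
      have hE0 : 0 < E p := lt_of_lt_of_le (by positivity) hshell.1
      have hSE : ‖selfEnergy L M β W p σ‖ ≤ s₂ := hs p σ hshell.1 hshell.2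
      have h6 := hN p σ
      have hw01 : hubbardCutoffWeightCT L M β μ K Λ p ∈ Set.Icc (0 : ℝ) 1 := salmhoferCutoff_mem_Icc _
      have h1w : ‖(((1 - hubbardCutoffWeightCT L M β μ K Λ p : ℝ) : ℂ))‖ ≤ 1 := by
        rw [Complex.norm_real, Real.norm_eq_abs, abs_le]
        constructor <;> linarith [hw01.1, hw01.2]
      have hg2 : ‖propCT L M β μ K p‖ ^ 2 = (E p)⁻¹ := klws_norm_propCT_sq L M β μ K p
      have hwdn : ‖(((wd p : ℝ) : ℂ))‖ = |wd p| := by rw [Complex.norm_real, Real.norm_eq_abs]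
      -- assemble with norms
      rw [norm_mul, norm_mul, norm_mul, norm_mul, norm_mul, norm_mul, norm_mul, hwdn, hBn]
      have hg0 := norm_nonneg (propCT L M β μ K p)
      have h10 := norm_nonneg (((1 - hubbardCutoffWeightCT L M β μ K Λ p : ℝ) : ℂ))
      calc |wd p| * (B * ‖propCT L M β μ K p‖) * (‖(((1 - hubbardCutoffWeightCT L M β μ K Λ p : ℝ) : ℂ))‖ * (B * ‖propCT L M β μ K p‖)) *
            (‖vertexFn L M β W 6 ![((p, σ), 0), ((p, σ), 1), Z₀, Z₁, Z₂, Z₃]‖ * ‖selfEnergy L M β W p σ‖)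
          ≤ |wd p| * (B * ‖propCT L M β μ K p‖) * (1 * (B * ‖propCT L M β μ K p‖)) * (N₆ * s₂) := by
            gcongr
        _ = B ^ 2 * N₆ * s₂ * (|wd p| * ‖propCT L M β μ K p‖ ^ 2) := by ring
        _ = B ^ 2 * N₆ * s₂ * (|wd p| / E p) := by rw [hg2, div_eq_mul_inv]
  -- sum over σ and p
  have hsum : ‖∑ p : FreqMomentum L M, ∑ σ : Fin 2,
        ((((wd p : ℝ) : ℂ) * (((B : ℝ) : ℂ) * propCT L M β μ K p)) *
            (((1 - hubbardCutoffWeightCT L M β μ K Λ p : ℝ) : ℂ) * (((B : ℝ) : ℂ) * propCT L M β μ K p))) *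
          (vertexFn L M β W 6 ![((p, σ), 0), ((p, σ), 1), Z₀, Z₁, Z₂, Z₃] * selfEnergy L M β W p σ)‖ ≤
      2 * (B ^ 2 * N₆ * s₂) * ∑ p : FreqMomentum L M, |wd p| / E p := by
    calc _ ≤ ∑ p : FreqMomentum L M, ‖∑ σ : Fin 2,
            ((((wd p : ℝ) : ℂ) * (((B : ℝ) : ℂ) * propCT L M β μ K p)) *
                (((1 - hubbardCutoffWeightCT L M β μ K Λ p : ℝ) : ℂ) * (((B : ℝ) : ℂ) * propCT L M β μ K p))) *
              (vertexFn L M β W 6 ![((p, σ), 0), ((p, σ), 1), Z₀, Z₁, Z₂, Z₃] * selfEnergy L M β W p σ)‖ := norm_sum_le _ _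
      _ ≤ ∑ p : FreqMomentum L M, ∑ σ : Fin 2, B ^ 2 * N₆ * s₂ * (|wd p| / E p) :=
          sum_le_sum fun p _ => (norm_sum_le _ _).trans (sum_le_sum fun σ _ => hterm p σ)
      _ = 2 * (B ^ 2 * N₆ * s₂) * ∑ p : FreqMomentum L M, |wd p| / E p := by
          simp only [Fin.sum_univ_two, mul_sum]
          exact sum_congr rfl fun p _ => by ring
  have hS := klws_sum_abs_derivWeight_div_le L M β μ K hK hβ hΛ hΛr
  have hS0 : 0 ≤ ∑ p : FreqMomentum L M, |wd p| / E p :=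
    sum_nonneg fun p _ => div_nonneg (abs_nonneg _) (by positivity)
  -- the prefactor
  rw [norm_mul, norm_inv, norm_pow, hBn, norm_mul, Complex.norm_ofNat]
  calc (B ^ 3)⁻¹ * (2 * ‖∑ p : FreqMomentum L M, ∑ σ : Fin 2,
          ((((wd p : ℝ) : ℂ) * (((B : ℝ) : ℂ) * propCT L M β μ K p)) *
              (((1 - hubbardCutoffWeightCT L M β μ K Λ p : ℝ) : ℂ) * (((B : ℝ) : ℂ) * propCT L M β μ K p))) *
            (vertexFn L M β W 6 ![((p, σ), 0), ((p, σ), 1), Z₀, Z₁, Z₂, Z₃] * selfEnergy L M β W p σ)‖)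
      ≤ (B ^ 3)⁻¹ * (2 * (2 * (B ^ 2 * N₆ * s₂) * ∑ p : FreqMomentum L M, |wd p| / E p)) := by
          gcongr
    _ = 4 * N₆ * s₂ * B⁻¹ * ∑ p : FreqMomentum L M, |wd p| / E p := by
          field_simp
          ring
    _ ≤ 4 * N₆ * s₂ * B⁻¹ * (256 / 3 / Λ ^ 3 * ((Λ * β / Real.pi + 3) * (1793 * Λ * (L : ℝ) ^ 2 + 704 * L))) := by
          refine mul_le_mul_of_nonneg_left hS ?_
          have : 0 ≤ B⁻¹ := inv_nonneg.2 hB.le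
          positivity

end Model

end Summit.HubbardSuperconductivity.HubbardSuperconductivity.Theorems.KLRegimeWick

end
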